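import Summits.ResolutionOfSingularities.ResolutionOfSingularities.Theorems.FrobeniusClosingSteerArithLeafWords
import Summits.ResolutionOfSingularities.ResolutionOfSingularities.Theorems.FrobeniusClosingSteerArithLeafLateSwitchRational
import HarnessLib

/-!
# hH2′ residue word — the NRA CUT `NRA = NRA-A ∧ NRA-U ∧ NRA-B` (res-L0-w41-plan-1 RULING 284 (b)): the two data, W-NRA-A (dischargeable:
  bi-cone + run reading), W-NRA-U (closed-modulo the one-axis H3 word, v3), W-NRA-B (OPEN residual), the run-level signature, and the PROVED glue up to hH2′
  BY NAME (`lateSwitchBinaryAStage_of_words`; res-L0-w41-strat-2 g4; 0 sorries)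

OURS (campaign `res-hironaka`, rung L ★L-G4, slot W4.1 · crux `Steer` (stmt-ResolutionOfSingularities-16345) · hARᵒ slot H2′ =
`ArithLeaf.LateSwitchBinaryAStageTwoN`). Candidates, not facts; nothing here is a statement of H. Hironakaʼs manuscript [claim: Hironaka2017,
status: under-review]; AI-written, AI review is weaker than expert review.

* `BinaryAxisDatumAt O R P s p i d u` — hH2′ʼs ON-AXIS BINARY DATUM at stage `i` w.r.t. the exceptional parameter `u` (verbatim body of the
  conclusion of `LateSwitchBinaryAStageTwoN`, `u` pulled out).
* `UniaxialDatumAt O R P s p i d u` — the UNIAXIAL datum `s i² − g² − c·m^d ∈ 𝔪^(d+1)`, `c` a unit, `m` a regular parameter with `v m < v u`.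
* **W-NRA-A `NonRationalAWindowTwoN`** (window-local; DISCHARGEABLE NOW = the bi-cone lemma `NonRationalWindow.BiCone` of
  `NRA/BiCone_sketch.lean` 69f5142878e5aabd + the run reading: S1b constancy at `j′` and `x_j` odd at `j′` ⇒ `ν′ = d + 1` ⇒ (c1)
  `g := F_j(1,T) ∈ 𝔮^d` at the NON-RATIONAL centre `𝔮` ⇒ bi-cone ⇒ `F_j = H(M₁, M₂)` (binary, `m = 2`) or `c·M₁^d` (uniaxial, `m = 1`)): at a late
  A-stage `j` of reduced order `d` whose window `(j, j′)` is residually NON-rational, the binary datum OR the uniaxial datum holds at `j` with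
  `u := ` any exceptional parameter of the step `j`.
* **W-NRA-U `UniaxialAStagesNotEternalTwoN`** (hH2′ʼs binders verbatim): uniaxial-and-not-binary A-stages with non-rational window do NOT
  recur beyond every stage. v3 STATUS: **CLOSED-MODULO the one-axis H3 word `H3OneAxisTwoN`** (res-L0-w41-tri-1 TRIAGE v6.48 (B)(C): a late
  uniaxial ON-AXIS A-stage has the height-2 H3 centre `Q := (u, m/u) ⊂ R_{j′}` with `c·m^d = c·u·(m/u)^d ∈ Q^(d+1)` and the `𝔪^(d+1)`-remainder in
  `u²R_{j′} ⊆ Q²`, so σ_top-maximality yields a later positive step of height ≥ 2 — excluded beyond the `¬ HeightTwoStepsInfinite` bound; glue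
  `uniaxialAStagesNotEternal_of_H3oneAxis` PROVED below). The binary datum itself is UNSATISFIABLE at such a window (v6.48 (A): the rational affine
  forms vanishing at `𝔮` form a LINE, so no second on-axis regular parameter completes `m` to an rsop part) — hence the uniaxial case cannot be
  folded into W-NRA-Aʼs binary conclusion (RULING 286 (d) re-cut request answered in the negative) and stays its own disjunct.
* **`H3OneAxisTwoN`** (v3; S–M kernel word = `ArithReductionLegality.H3_of_pieces` re-run at the residue zero `(0 : 1)`, binder for binder minus
  `m₂`, `Ψ` (replaced by `c * m ^ d`), `v m₂ < v u` and the residue-zero hypothesis; tri-1 v6.48 (B) `H3_oneAxis_of_pieces`): at a late A-STAGE with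
  the uniaxial on-axis congruence there is a later positive step of height ≥ 2. Proof route: `ArithReductionLegality.exists_posStepTwo_of_residue_zero`ʼs
  argument with the centre `(u, m/u)`.
* `LateBinaryAStageOfNonRationalAWindowsTwoN` — the RUN-LEVEL SIGNATURE (hH2′ʼs binders + «non-rational A-windows beyond every stage» ⇒ hH2′ʼs
  conclusion), and the PROVED glue `lateBinaryAStage_of_nonRationalAWindows : W-NRA-A → W-NRA-U → it` (pure logic: `frequently_or_split`).
* **W-NRA-B `NonRationalBWindowsTwoN`** (OPEN residual word, v2; shape = res-D-repro-2 20:13:53Z): hH2′ʼs binders verbatim + (B1) «from some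
  stage on every A-STAGE window is residually rational» + (B2) «residually NON-rational windows recur beyond every stage» (so the late
  non-rational windows all start at B-stages) ⇒ hH2′ʼs conclusion. Why it might fail / why it is a separate word: every rational engine
  (F2/F1′/Fβ window kernels behind `BinaryResidue.binaryAStage_of_lateSwitch_run`) eats B-WINDOW rationality through the adapted coordinates
  `𝔪_{S′} = (x, u′)`, which exist only for a residually rational window (res-D-repro-2 ANSWER 20:08:15Z: «NRA-B is REAL under the current
  kernels»); a non-rational B-window kernel needs coefficients that land in `S` only after an étale base change, and at a B-stage the
  square-class cleaning kills the bi-cone rigidity that serves W-NRA-A.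
* **TRICHOTOMY GLUE, PROVED**: `lateSwitchBinaryAStage_of_trichotomy : LateBinaryAStageOfNonRationalAWindowsTwoN → NonRationalBWindowsTwoN →
  ArithLeaf.LateSwitchBinaryAStageTwoN` — case (R) «∃ N, all visit-pair windows ≥ N rational» is res-D-repro-2ʼs tree theorem
  `BinaryResidue.lateSwitchBinaryAStage_of_rationalWindows` (p564716) re-based at `max N N₁`; ¬(R) = (B2); then (NR-A) is the first binder,
  ¬(NR-A) = (B1) feeds W-NRA-B. Hence (v3) **hH2′ = CLOSED-MODULO {W-NRA-A (⇐ `BiCone` + run reading), `H3OneAxisTwoN` (S–M), W-NRA-B (OPEN)}**: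
  `lateSwitchBinaryAStage_of_words hW h3 hB := lateSwitchBinaryAStage_of_trichotomy (lateBinaryAStage_of_nonRationalAWindows hW
  (uniaxialAStagesNotEternal_of_H3oneAxis h3)) hB` (PROVED below).
[cite: Matsumura1987, Thm. 14.2] [folklore]
-/

-- `Summit.<S>.<S>.…` duplicates the summit name by design (single-problem summit).
set_option linter.dupNamespace false

open IsLocalRing
open Literature.AlgebraicGeometry.Resolution
open Summit.ResolutionOfSingularities.ResolutionOfSingularities.Theorems.SwitchingDichotomy.Words
open Summit.ResolutionOfSingularities.ResolutionOfSingularities.Theorems.SteerRankThinness (Concl HasProperCoarsening)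
open Summit.ResolutionOfSingularities.ResolutionOfSingularities.Theorems.SwitchingDichotomy.ArithReduction
open Summit.ResolutionOfSingularities.ResolutionOfSingularities.Theorems.SwitchingDichotomy

namespace Summit.ResolutionOfSingularities.ResolutionOfSingularities.Theorems.SwitchingDichotomy.NonRationalWindow

variable {K : Type} [Field K]

/-- **hH2′ʼs ON-AXIS BINARY DATUM** at stage `i` for the reduced order `d` and the exceptional parameter `u`: `s i ^ p − g² − Ψ(m₁, m₂) ∈ 𝔪^(d+1)`,
`(m₁, m₂)` part of a r.s.o.p., `Ψ` a form of degree `d`, `u` exceptional at `i`, `v m₁ < v u`, `v m₂ < v u` (the body of the conclusion of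
`ArithLeaf.LateSwitchBinaryAStageTwoN`, with `u` as an argument). OURS. (folklore) -/
def BinaryAxisDatumAt (O : ValuationSubring K) (R : ℕ → Subring K) (P : (i : ℕ) → Ideal (R i)) (s : ℕ → K)
    (p i d : ℕ) (u : K) : Prop :=
  ∃ (_ : IsLocalRing (R i)) (hs : s i ^ p ∈ R i) (g m₁ m₂ : R i) (Ψ : MvPolynomial (Fin 2) (R i)),
    IsRsopPart ![m₁, m₂] ∧ Ψ.IsHomogeneous d ∧
    (⟨s i ^ p, hs⟩ : R i) - g ^ 2 - MvPolynomial.eval ![m₁, m₂] Ψ ∈ maximalIdeal (R i) ^ (d + 1) ∧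
    ((∃ hu : u ∈ R i, (⟨u, hu⟩ : R i) ∈ P i) ∧ u ≠ 0 ∧ ∀ y : R i, y ∈ P i → O.valuation (y : K) ≤ O.valuation u) ∧
    O.valuation (m₁ : K) < O.valuation u ∧ O.valuation (m₂ : K) < O.valuation u

/-- **The UNIAXIAL DATUM** at stage `i`: `s i ^ p − g² − c · m ^ d ∈ 𝔪^(d+1)` with `c` a unit, `m` a regular parameter (`m ∈ 𝔪 ∖ 𝔪²`), `u`
exceptional at `i` and `v m < v u` (the initial form is `c̄ · M^d`, ON-AXIS). OURS. (folklore) -/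
def UniaxialDatumAt (O : ValuationSubring K) (R : ℕ → Subring K) (P : (i : ℕ) → Ideal (R i)) (s : ℕ → K)
    (p i d : ℕ) (u : K) : Prop :=
  ∃ (_ : IsLocalRing (R i)) (hs : s i ^ p ∈ R i) (g m c : R i),
    IsUnit c ∧ m ∈ maximalIdeal (R i) ∧ m ∉ maximalIdeal (R i) ^ 2 ∧
    (⟨s i ^ p, hs⟩ : R i) - g ^ 2 - c * m ^ d ∈ maximalIdeal (R i) ^ (d + 1) ∧
    ((∃ hu : u ∈ R i, (⟨u, hu⟩ : R i) ∈ P i) ∧ u ≠ 0 ∧ ∀ y : R i, y ∈ P i → O.valuation (y : K) ≤ O.valuation u) ∧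
    O.valuation (m : K) < O.valuation u

/-- **W-NRA-A · `NonRationalAWindowTwoN`** (window-local; dischargeable: bi-cone + run reading, see the module docstring). Binders: core datum
(for the PERFECT residue fields of the members, `MembersPerfectResidue`), the run, regular 4-dimensional members, N4ʼs height-one clause and Hγ
at late visits (for `VisitLawDelta.visitLaw₂_of_run`), the S1b constant reduced order `d ≥ 3` at late point steps; then a late A-STAGE `j` with
visit pair `(j, j′)`, an exceptional parameter `u` of the step `j`, and a residually NON-RATIONAL window (negation of res-D-repro-2ʼs value-form
`hrat`). Conclusion: the binary OR the uniaxial datum at `j` w.r.t. `u`. OURS. (folklore) -/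
def NonRationalAWindowTwoN : Prop :=
  ∀ p : ℕ, p = 2 →
    ∀ (k K : Type) [Field k] [CharP k p] [PerfectField k] [Field K] [Algebra k K]
    (O : ValuationSubring K) (A₀ : Subalgebra k K) (h₀ : A₀.toSubring ≤ O.toSubring) (t : K),
    CoreDatum p 4 k K O A₀ h₀ t →
    ∀ (R : ℕ → Subring K) (P : (i : ℕ) → Ideal (R i)) (s : ℕ → K),
      R 0 = locAtCentre A₀.toSubring O → IsSteeredRun O R P t p s →
      (∀ i, IsRegularLocalRing (R i)) → (∀ i, ringKrullDim (R i) = (4 : ℕ)) →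
      ∀ N₁ : ℕ,
      (∀ j, N₁ ≤ j → IsPointStep R P j → ∀ (hs' : s j ^ p ∈ R j) (Q : Ideal (R j)) [Q.IsPrime], Q.height = 1 →
          ¬ SigmaTopLegality.IsSingPrime (R j) p ⟨s j ^ p, hs'⟩ Q) →
      (∀ (j j' : ℕ) (x : K), N₁ ≤ j → IsVisitPair R P j j' →
        ((∃ h : x ∈ R j, (⟨x, h⟩ : R j) ∈ P j) ∧ x ≠ 0 ∧ ∀ y : R j, y ∈ P j → O.valuation (y : K) ≤ O.valuation x) →
        ∀ l, j < l → l < j' → ∃ hx : x ∈ R l, P l = Ideal.span {(⟨x, hx⟩ : R l)}) →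
      ∀ d : ℕ, 3 ≤ d →
      (∀ i, N₁ ≤ i → IsPointStep R P i → HasReducedOrderAt R s p i d) →
      ∀ (j j' : ℕ) (u : K), N₁ ≤ j → IsVisitPair R P j j' → IsAStageAt R P s p j d →
        ((∃ hu : u ∈ R j, (⟨u, hu⟩ : R j) ∈ P j) ∧ u ≠ 0 ∧ ∀ y : R j, y ∈ P j → O.valuation (y : K) ≤ O.valuation u) →
        (¬ ∀ a ∈ R j', ∃ b ∈ R j, O.valuation (a - b) < 1) →
        BinaryAxisDatumAt O R P s p j d u ∨ UniaxialDatumAt O R P s p j d u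

/-- **W-NRA-U · `UniaxialAStagesNotEternalTwoN`** (OPEN residual word; hH2′ʼs binders verbatim + the S1b data): A-stages whose window is residually
non-rational and which carry the uniaxial datum but NOT the binary datum do not recur beyond every stage. Why it might fail: see the module
docstring. OURS. (folklore) -/
def UniaxialAStagesNotEternalTwoN : Prop :=
  ∀ p : ℕ, p = 2 →
    ∀ (k K : Type) [Field k] [CharP k p] [PerfectField k] [Field K] [Algebra k K]
    (O : ValuationSubring K) (A₀ : Subalgebra k K) (h₀ : A₀.toSubring ≤ O.toSubring) (t : K),
    CoreDatum p 4 k K O A₀ h₀ t → ¬ HasProperCoarsening O →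
    ∀ (R : ℕ → Subring K) (P : (i : ℕ) → Ideal (R i)) (s : ℕ → K),
      R 0 = locAtCentre A₀.toSubring O → NormalAt O (R 0) p t → IsSteeredRun O R P t p s →
      (¬ ∃ i₀ c : ℕ, 1 ≤ c ∧ IsDominantTail R P i₀ c) →
      (∃ i₀ : ℕ, ∀ i, i₀ ≤ i → IsHighOrderAt R s p i) →
      ¬ HeightTwoStepsInfinite R P → {j | IsPosStep R P j}.Infinite →
      (∀ i₀ : ℕ, ∃ i, i₀ ≤ i ∧ IsPointStep R P i ∧
        ∀ hs : s i ^ p ∈ R i, ¬ HasIsolatedSingularity (RadicandRing (R i) p ⟨s i ^ p, hs⟩)) →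
      (¬ ∃ i₀ : ℕ, ∃ x : K, x ≠ 0 ∧ x ∈ O ∧ O.valuation x < 1 ∧
        ∀ i, i₀ ≤ i → ∀ y ∈ R i, O.valuation y < 1 → ∃ j, i < j ∧ y / x ∈ R j) →
      (∀ i₀ : ℕ, ∃ i, i₀ ≤ i ∧ OddCleanedPointStepAt R P s p i) →
      (∀ i, IsRegularLocalRing (R i)) → (∀ i, ringKrullDim (R i) = (4 : ℕ)) →
      ∀ N₁ : ℕ,
      (∀ j, N₁ ≤ j → IsPointStep R P j → ∀ (hs' : s j ^ p ∈ R j) (Q : Ideal (R j)) [Q.IsPrime], Q.height = 0 →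
          ¬ SigmaTopLegality.IsSingPrime (R j) p ⟨s j ^ p, hs'⟩ Q) →
      (∀ j, N₁ ≤ j → IsPointStep R P j → ∀ (hs' : s j ^ p ∈ R j) (Q : Ideal (R j)) [Q.IsPrime], Q.height = 1 →
          ¬ SigmaTopLegality.IsSingPrime (R j) p ⟨s j ^ p, hs'⟩ Q) →
      (∀ (j j' : ℕ) (x : K), N₁ ≤ j → IsVisitPair R P j j' →
        ((∃ h : x ∈ R j, (⟨x, h⟩ : R j) ∈ P j) ∧ x ≠ 0 ∧ ∀ y : R j, y ∈ P j → O.valuation (y : K) ≤ O.valuation x) →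
        ∀ l, j < l → l < j' → ∃ hx : x ∈ R l, P l = Ideal.span {(⟨x, hx⟩ : R l)}) →
      ∀ (d i₁ : ℕ), Odd d → 3 ≤ d →
      (∀ i, i₁ ≤ i → IsPointStep R P i → HasReducedOrderAt R s p i d) →
      (∀ i₀, ∃ i, i₀ ≤ i ∧ IsAStageAt R P s p i d) →
      ¬ (∀ i₀ : ℕ, ∃ i, i₀ ≤ i ∧ IsAStageAt R P s p i d ∧ ∃ (i' : ℕ) (u : K), IsVisitPair R P i i' ∧
          (¬ ∀ a ∈ R i', ∃ b ∈ R i, O.valuation (a - b) < 1) ∧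
          UniaxialDatumAt O R P s p i d u ∧ ¬ BinaryAxisDatumAt O R P s p i d u)

/-- **RUN-LEVEL SIGNATURE · `LateBinaryAStageOfNonRationalAWindowsTwoN`**: hH2′ʼs binders verbatim + «beyond every stage an A-stage of reduced
order `d` whose window is residually non-rational» ⇒ hH2′ʼs CONCLUSION verbatim. PROVED below from W-NRA-A and W-NRA-U
(`lateBinaryAStage_of_nonRationalAWindows`). OURS. (folklore) -/
def LateBinaryAStageOfNonRationalAWindowsTwoN : Prop :=
  ∀ p : ℕ, p = 2 →
    ∀ (k K : Type) [Field k] [CharP k p] [PerfectField k] [Field K] [Algebra k K]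
    (O : ValuationSubring K) (A₀ : Subalgebra k K) (h₀ : A₀.toSubring ≤ O.toSubring) (t : K),
    CoreDatum p 4 k K O A₀ h₀ t → ¬ HasProperCoarsening O →
    ∀ (R : ℕ → Subring K) (P : (i : ℕ) → Ideal (R i)) (s : ℕ → K),
      R 0 = locAtCentre A₀.toSubring O → NormalAt O (R 0) p t → IsSteeredRun O R P t p s →
      (¬ ∃ i₀ c : ℕ, 1 ≤ c ∧ IsDominantTail R P i₀ c) →
      (∃ i₀ : ℕ, ∀ i, i₀ ≤ i → IsHighOrderAt R s p i) →
      ¬ HeightTwoStepsInfinite R P → {j | IsPosStep R P j}.Infinite →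
      (∀ i₀ : ℕ, ∃ i, i₀ ≤ i ∧ IsPointStep R P i ∧
        ∀ hs : s i ^ p ∈ R i, ¬ HasIsolatedSingularity (RadicandRing (R i) p ⟨s i ^ p, hs⟩)) →
      (¬ ∃ i₀ : ℕ, ∃ x : K, x ≠ 0 ∧ x ∈ O ∧ O.valuation x < 1 ∧
        ∀ i, i₀ ≤ i → ∀ y ∈ R i, O.valuation y < 1 → ∃ j, i < j ∧ y / x ∈ R j) →
      (∀ i₀ : ℕ, ∃ i, i₀ ≤ i ∧ OddCleanedPointStepAt R P s p i) →
      (∀ i, IsRegularLocalRing (R i)) → (∀ i, ringKrullDim (R i) = (4 : ℕ)) →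
      ∀ N₁ : ℕ,
      (∀ j, N₁ ≤ j → IsPointStep R P j → ∀ (hs' : s j ^ p ∈ R j) (Q : Ideal (R j)) [Q.IsPrime], Q.height = 0 →
          ¬ SigmaTopLegality.IsSingPrime (R j) p ⟨s j ^ p, hs'⟩ Q) →
      (∀ j, N₁ ≤ j → IsPointStep R P j → ∀ (hs' : s j ^ p ∈ R j) (Q : Ideal (R j)) [Q.IsPrime], Q.height = 1 →
          ¬ SigmaTopLegality.IsSingPrime (R j) p ⟨s j ^ p, hs'⟩ Q) →
      (∀ (j j' : ℕ) (x : K), N₁ ≤ j → IsVisitPair R P j j' →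
        ((∃ h : x ∈ R j, (⟨x, h⟩ : R j) ∈ P j) ∧ x ≠ 0 ∧ ∀ y : R j, y ∈ P j → O.valuation (y : K) ≤ O.valuation x) →
        ∀ l, j < l → l < j' → ∃ hx : x ∈ R l, P l = Ideal.span {(⟨x, hx⟩ : R l)}) →
      ∀ (d i₁ : ℕ), Odd d → 3 ≤ d →
      (∀ i, i₁ ≤ i → IsPointStep R P i → HasReducedOrderAt R s p i d) →
      (∀ i₀, ∃ i, i₀ ≤ i ∧ IsAStageAt R P s p i d) →
      (∀ i₀ : ℕ, ∃ i i' : ℕ, i₀ ≤ i ∧ IsAStageAt R P s p i d ∧ IsVisitPair R P i i' ∧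
          ¬ ∀ a ∈ R i', ∃ b ∈ R i, O.valuation (a - b) < 1) →
      ∀ i₀ : ℕ, ∃ i, i₀ ≤ i ∧ IsAStageAt R P s p i d ∧
        ∃ (_ : IsLocalRing (R i)) (hs : s i ^ p ∈ R i) (g m₁ m₂ : R i) (Ψ : MvPolynomial (Fin 2) (R i)) (u : K),
          IsRsopPart ![m₁, m₂] ∧ Ψ.IsHomogeneous d ∧
          (⟨s i ^ p, hs⟩ : R i) - g ^ 2 - MvPolynomial.eval ![m₁, m₂] Ψ ∈ maximalIdeal (R i) ^ (d + 1) ∧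
          ((∃ hu : u ∈ R i, (⟨u, hu⟩ : R i) ∈ P i) ∧ u ≠ 0 ∧ ∀ y : R i, y ∈ P i → O.valuation (y : K) ≤ O.valuation u) ∧
          O.valuation (m₁ : K) < O.valuation u ∧ O.valuation (m₂ : K) < O.valuation u

/-- **W-NRA-B · `NonRationalBWindowsTwoN`** (OPEN residual word of the NRA cut, RULING 284 (b); shape res-D-repro-2 20:13:53Z): hH2′ʼs
binders verbatim + (B1) «every late A-stage window is residually rational» + (B2) «residually non-rational windows recur» (hence at B-stages)
⇒ hH2′ʼs conclusion verbatim. The regime complementary to `BinaryResidue.lateSwitchBinaryAStage_of_rationalWindows` (all late windows rational)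
and to `LateBinaryAStageOfNonRationalAWindowsTwoN` (non-rational A-windows recur); see `lateSwitchBinaryAStage_of_trichotomy`. Why it might
fail: the rational window kernels need adapted coordinates at the B-window; a residually non-rational B-window kernel is not in the tree and the
bi-cone rigidity of W-NRA-A is not available after the square-class cleaning at a B-stage (module docstring). OURS. (folklore) -/
def NonRationalBWindowsTwoN : Prop :=
  ∀ p : ℕ, p = 2 →
    ∀ (k K : Type) [Field k] [CharP k p] [PerfectField k] [Field K] [Algebra k K]
    (O : ValuationSubring K) (A₀ : Subalgebra k K) (h₀ : A₀.toSubring ≤ O.toSubring) (t : K),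
    CoreDatum p 4 k K O A₀ h₀ t → ¬ HasProperCoarsening O →
    ∀ (R : ℕ → Subring K) (P : (i : ℕ) → Ideal (R i)) (s : ℕ → K),
      R 0 = locAtCentre A₀.toSubring O → NormalAt O (R 0) p t → IsSteeredRun O R P t p s →
      (¬ ∃ i₀ c : ℕ, 1 ≤ c ∧ IsDominantTail R P i₀ c) →
      (∃ i₀ : ℕ, ∀ i, i₀ ≤ i → IsHighOrderAt R s p i) →
      ¬ HeightTwoStepsInfinite R P → {j | IsPosStep R P j}.Infinite →
      (∀ i₀ : ℕ, ∃ i, i₀ ≤ i ∧ IsPointStep R P i ∧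
        ∀ hs : s i ^ p ∈ R i, ¬ HasIsolatedSingularity (RadicandRing (R i) p ⟨s i ^ p, hs⟩)) →
      (¬ ∃ i₀ : ℕ, ∃ x : K, x ≠ 0 ∧ x ∈ O ∧ O.valuation x < 1 ∧
        ∀ i, i₀ ≤ i → ∀ y ∈ R i, O.valuation y < 1 → ∃ j, i < j ∧ y / x ∈ R j) →
      (∀ i₀ : ℕ, ∃ i, i₀ ≤ i ∧ OddCleanedPointStepAt R P s p i) →
      (∀ i, IsRegularLocalRing (R i)) → (∀ i, ringKrullDim (R i) = (4 : ℕ)) →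
      ∀ N₁ : ℕ,
      (∀ j, N₁ ≤ j → IsPointStep R P j → ∀ (hs' : s j ^ p ∈ R j) (Q : Ideal (R j)) [Q.IsPrime], Q.height = 0 →
          ¬ SigmaTopLegality.IsSingPrime (R j) p ⟨s j ^ p, hs'⟩ Q) →
      (∀ j, N₁ ≤ j → IsPointStep R P j → ∀ (hs' : s j ^ p ∈ R j) (Q : Ideal (R j)) [Q.IsPrime], Q.height = 1 →
          ¬ SigmaTopLegality.IsSingPrime (R j) p ⟨s j ^ p, hs'⟩ Q) →
      (∀ (j j' : ℕ) (x : K), N₁ ≤ j → IsVisitPair R P j j' →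
        ((∃ h : x ∈ R j, (⟨x, h⟩ : R j) ∈ P j) ∧ x ≠ 0 ∧ ∀ y : R j, y ∈ P j → O.valuation (y : K) ≤ O.valuation x) →
        ∀ l, j < l → l < j' → ∃ hx : x ∈ R l, P l = Ideal.span {(⟨x, hx⟩ : R l)}) →
      ∀ (d i₁ : ℕ), Odd d → 3 ≤ d →
      (∀ i, i₁ ≤ i → IsPointStep R P i → HasReducedOrderAt R s p i d) →
      (∀ i₀, ∃ i, i₀ ≤ i ∧ IsAStageAt R P s p i d) →
      -- (B1) from some stage on, every A-STAGE window is residually rational (value form)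
      (∃ i₀ : ℕ, ∀ i i' : ℕ, i₀ ≤ i → IsAStageAt R P s p i d → IsVisitPair R P i i' →
          ∀ a ∈ R i', ∃ b ∈ R i, O.valuation (a - b) < 1) →
      -- (B2) residually NON-rational windows recur beyond every stage (value form, verbatim negation of the rational binder)
      (∀ N : ℕ, ∃ j j' : ℕ, N ≤ j ∧ IsVisitPair R P j j' ∧ ¬ ∀ a ∈ R j', ∃ b ∈ R j, O.valuation (a - b) < 1) →
      ∀ i₀ : ℕ, ∃ i, i₀ ≤ i ∧ IsAStageAt R P s p i d ∧
        ∃ (_ : IsLocalRing (R i)) (hs : s i ^ p ∈ R i) (g m₁ m₂ : R i) (Ψ : MvPolynomial (Fin 2) (R i)) (u : K),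
          IsRsopPart ![m₁, m₂] ∧ Ψ.IsHomogeneous d ∧
          (⟨s i ^ p, hs⟩ : R i) - g ^ 2 - MvPolynomial.eval ![m₁, m₂] Ψ ∈ maximalIdeal (R i) ^ (d + 1) ∧
          ((∃ hu : u ∈ R i, (⟨u, hu⟩ : R i) ∈ P i) ∧ u ≠ 0 ∧ ∀ y : R i, y ∈ P i → O.valuation (y : K) ≤ O.valuation u) ∧
          O.valuation (m₁ : K) < O.valuation u ∧ O.valuation (m₂ : K) < O.valuation u

/-- **`H3OneAxisTwoN` — the ONE-AXIS H3 kernel word** (S–M; res-L0-w41-tri-1 TRIAGE v6.48 (B) `H3_oneAxis_of_pieces`): the binder list of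
`ArithReductionLegality.H3_of_pieces` (run of exponent 2, domination of `R 0`, recurring point steps, the ν-free visit law (S1a) beyond `N`,
regular members of dimension `n ≥ 3`, N4ʼs height-0/1 clauses beyond `N`, `d` odd) and then, at an A-STAGE `i ≥ N`: a UNIAXIAL on-axis congruence
`s i² − g² − c·m^d ∈ 𝔪^(d+1)` with `m ∈ 𝔪 ∖ 𝔪²`, `u` exceptional at `i`, `v m < v u` (no second parameter, no form `Ψ`, no residue-zero hypothesis:
`c̄·X^d` vanishes at `(0 : 1)` identically) ⇒ a later positive step of height ≥ 2. Proof = `ArithReductionLegality.exists_posStepTwo_of_residue_zero`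
at `(a, b) = (0, 1)`: centre `Q := (u, m/u)` in `R_{j′} = R_{i+1}`, `c·m^d = c·u·(m/u)^d ∈ Q^(d+1)`, remainder `∈ u^(d+1)R ⇒ /u^(d−1) ∈ u²R ⊆ Q²`, square
part `(g − G′)/u^((d−1)/2) ∈ R_{j′}` by normality. (If `c ∈ 𝔪` the hypotheses contradict the exact cleaned order `d` of the A-stage — vacuous, fine.)
OURS. (folklore) -/
def H3OneAxisTwoN : Prop :=
  ∀ (K : Type) [Field K] [CharP K 2] (O : ValuationSubring K) (R : ℕ → Subring K) (P : (i : ℕ) → Ideal (R i)) (t : K) (s : ℕ → K),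
    IsSteeredRun O R P t 2 s → SubringDominates (R 0) O.toSubring →
    (∀ i₀, ∃ i, i₀ ≤ i ∧ IsPointStep R P i) →
    ∀ N : ℕ,
    (∀ (j j' : ℕ) (x : K) (ν : ℕ), N ≤ j → IsVisitPair R P j j' →
      ((∃ hx : x ∈ R j, (⟨x, hx⟩ : R j) ∈ P j) ∧ x ≠ 0 ∧ ∀ y : R j, y ∈ P j → O.valuation (y : K) ≤ O.valuation x) →
      HasCleanedOrderAt R s 2 j ν →
      R j' = R (j + 1) ∧ ∃ G W : K, G ∈ R j' ∧ W ∈ R j' ∧ W⁻¹ ∈ R j' ∧ W ≠ 0 ∧ s j' * x ^ (ν / 2) * W = s j - G) →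
    (∀ i, IsRegularLocalRing (R i)) → ∀ n : ℕ, 3 ≤ n → (∀ i, ringKrullDim (R i) = n) →
    (∀ j, N ≤ j → IsPointStep R P j → ∀ (hs' : s j ^ 2 ∈ R j) (Q : Ideal (R j)) [Q.IsPrime], Q.height = 0 →
      ¬ SigmaTopLegality.IsSingPrime (R j) 2 ⟨s j ^ 2, hs'⟩ Q) →
    (∀ j, N ≤ j → IsPointStep R P j → ∀ (hs' : s j ^ 2 ∈ R j) (Q : Ideal (R j)) [Q.IsPrime], Q.height = 1 →
      ¬ SigmaTopLegality.IsSingPrime (R j) 2 ⟨s j ^ 2, hs'⟩ Q) →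
    ∀ d : ℕ, Odd d →
    ∀ (i : ℕ), N ≤ i → IsAStageAt R P s 2 i d →
      ∀ (_ : IsLocalRing (R i)) (hs : s i ^ 2 ∈ R i) (g m c : R i) (u : K),
        m ∈ maximalIdeal (R i) → m ∉ maximalIdeal (R i) ^ 2 →
        (⟨s i ^ 2, hs⟩ : R i) - g ^ 2 - c * m ^ d ∈ maximalIdeal (R i) ^ (d + 1) →
        ((∃ hu : u ∈ R i, (⟨u, hu⟩ : R i) ∈ P i) ∧ u ≠ 0 ∧ ∀ y : R i, y ∈ P i → O.valuation (y : K) ≤ O.valuation u) →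
        O.valuation (m : K) < O.valuation u →
        ∃ j', i < j' ∧ SigmaTopLegality.IsPosStep R P j' ∧ 2 ≤ (P j').height

end Summit.ResolutionOfSingularities.ResolutionOfSingularities.Theorems.SwitchingDichotomy.NonRationalWindow
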